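import Mathlib.AlgebraicGeometry.AlgClosed.Basic
import Mathlib.AlgebraicGeometry.Morphisms.ClosedImmersion
import Mathlib.CategoryTheory.Comma.Over.Basic
import HarnessLib

/-!
# A closed subscheme through which all `K`-points factor is everything (`K` algebraically closed, `X` reduced of finite type)
# ([GortzWedhorn2020] Prop. 3.35 / Cor. 3.36 (Nullstellensatz: closed points are `K`-points); [Hartshorne1977] II Ex. 3.14)

Cell `hodgecm-mathlib` (D-0151), F-DAG F3 (i) «all geometric points in `K(L)` ⇒ `K(L) = A`» (lead B-p03 (g17), seam
2026-08-30 06:54:16Z; sequencer B-plan1 (g16) 06:54:45Z), the generic brick (B-p13 (g19)).  PROOF lane, theorems only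
(no definition, no named fact, no instance, no `sorry`).

For `K` an algebraically closed field and `f : X → Spec K` locally of finite type, the closed points of `X` are exactly the
images of the `K`-points `Spec K → X` over `K` (Mathlib `AlgebraicGeometry.pointOfClosedPoint`, `pointEquivClosedPoint`;
[GortzWedhorn2020] Cor. 3.36), and `X` is a Jacobson space (Mathlib `LocallyOfFiniteType.jacobsonSpace`): every non-empty
locally closed subset contains a closed point.  Hence:

* `surjective_of_forall_point_factors` — if `i : Z → X` has closed image (e.g. a closed immersion) and EVERY `K`-point
  `p : Spec K → X` over `K` factors through `i`, then `i` is surjective (the open complement of the image, if non-empty,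
  would contain a closed point, i.e. a `K`-point);
* `isIso_of_isClosedImmersion_of_forall_point_factors` — if moreover `i` is a closed immersion and `X` is REDUCED, `i` is
  an isomorphism (Mathlib `isIso_of_isClosedImmersion_of_surjective`);
* `Over.isIso_of_isClosedImmersion_of_forall_point_factors` — the same for `i : Z ⟶ X` in `Over (Spec K)` with the
  `K`-points read as morphisms `Over.mk (𝟙 (Spec K)) ⟶ X` (the shape F3 (i) consumes, with `Z ↪ A` the closed subscheme
  representing `K(L)` of ★ `AbelianSchemeKOfLClosedSubscheme`).

HC_CM is proved only modulo the 7 printed citations until rung 0 closes; count-neutral F-DAG capital.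

## References
* [GortzWedhorn2020] U. Görtz, T. Wedhorn, *Algebraic Geometry I*, 2nd ed. (2020), Prop. 3.35 (p. 82) and Cor. 3.36 (p. 83).
* [Hartshorne1977] R. Hartshorne, *Algebraic Geometry* (1977), II Ex. 2.9 and Ex. 3.14 (closed points of schemes of finite
  type over a field are dense).
-/

noncomputable section

universe u

open CategoryTheory CategoryTheory.Limits AlgebraicGeometry

namespace Literature.AlgebraicGeometry.Morphisms

variable {K : Type u} [Field K] [IsAlgClosed K] {X Z : Scheme.{u}} (f : X ⟶ Spec (.of K)) [LocallyOfFiniteType f]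
  (i : Z ⟶ X)

/-- **All `K`-points factor ⇒ surjective** (`K` algebraically closed, `X → Spec K` locally of finite type): if the image of
`i : Z → X` is closed and every `K`-point `p : Spec K → X` over `K` factors through `i`, then `i` is surjective — a
non-empty open complement would contain a closed point ([GortzWedhorn2020] Prop. 3.35: `X` is Jacobson), and closed points
are `K`-points (Cor. 3.36, Mathlib `pointOfClosedPoint`). [cite: GortzWedhorn2020, Prop. 3.35 (p. 82) and Cor. 3.36 (p. 83)] -/
theorem surjective_of_forall_point_factors (hi : IsClosed (Set.range i.base))
    (h : ∀ p : Spec (.of K) ⟶ X, p ≫ f = 𝟙 _ → ∃ z : Spec (.of K) ⟶ Z, z ≫ i = p) : Surjective i := by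
  haveI : JacobsonSpace X := LocallyOfFiniteType.jacobsonSpace f
  refine ⟨fun x => ?_⟩
  by_contra hx
  -- the open complement of the image is non-empty, hence contains a closed point `y`
  have hne : ((Set.range i.base)ᶜ).Nonempty := ⟨x, hx⟩
  obtain ⟨y, hy, hyc⟩ := nonempty_inter_closedPoints hne hi.isOpen_compl.isLocallyClosed
  -- which is a `K`-point, hence factors through `i`
  obtain ⟨z, hz⟩ := h (pointOfClosedPoint f y hyc) (pointOfClosedPoint_comp f y hyc)
  apply hy
  refine ⟨z.base (IsLocalRing.closedPoint K), ?_⟩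
  rw [← Scheme.Hom.comp_apply, hz, pointOfClosedPoint_apply]

/-- **A CLOSED SUBSCHEME THROUGH WHICH ALL `K`-POINTS FACTOR IS EVERYTHING**: for `K` algebraically closed, `X → Spec K`
locally of finite type with `X` REDUCED, and `i : Z → X` a closed immersion such that every `K`-point of `X` over `K`
factors through `i`, the closed immersion `i` is an isomorphism (surjective by `surjective_of_forall_point_factors`, then
Mathlib `isIso_of_isClosedImmersion_of_surjective`). [cite: GortzWedhorn2020, Prop. 3.35 (p. 82) and Cor. 3.36 (p. 83)]
[cite: Hartshorne1977, II Ex. 3.14] -/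
theorem isIso_of_isClosedImmersion_of_forall_point_factors [IsClosedImmersion i] [IsReduced X]
    (h : ∀ p : Spec (.of K) ⟶ X, p ≫ f = 𝟙 _ → ∃ z : Spec (.of K) ⟶ Z, z ≫ i = p) : IsIso i := by
  haveI : Surjective i := surjective_of_forall_point_factors f i i.isClosedEmbedding.isClosed_range h
  exact isIso_of_isClosedImmersion_of_surjective i

/-- `Set.range` form of the hypothesis: it suffices that every `K`-point over `K` has its image point in the image of `i`.
[cite: GortzWedhorn2020, Prop. 3.35 (p. 82) and Cor. 3.36 (p. 83)] -/
theorem surjective_of_forall_point_mem_range (hi : IsClosed (Set.range i.base))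
    (h : ∀ p : Spec (.of K) ⟶ X, p ≫ f = 𝟙 _ → p.base (IsLocalRing.closedPoint K) ∈ Set.range i.base) :
    Surjective i := by
  haveI : JacobsonSpace X := LocallyOfFiniteType.jacobsonSpace f
  refine ⟨fun x => ?_⟩
  by_contra hx
  have hne : ((Set.range i.base)ᶜ).Nonempty := ⟨x, hx⟩
  obtain ⟨y, hy, hyc⟩ := nonempty_inter_closedPoints hne hi.isOpen_compl.isLocallyClosed
  apply hy
  have hmem := h (pointOfClosedPoint f y hyc) (pointOfClosedPoint_comp f y hyc)
  rwa [pointOfClosedPoint_apply] at hmem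

/-! ### Over `Spec K`: `K`-points as morphisms `Over.mk (𝟙 (Spec K)) ⟶ X` -/

/-- **Over-category form** (the shape F3 (i) reads): for `X Z : Over (Spec K)` with `X` reduced and locally of finite
type over the algebraically closed `K`, a closed immersion `i : Z ⟶ X` over `K` through which every `K`-point
`Over.mk (𝟙 (Spec K)) ⟶ X` factors is an isomorphism in `Over (Spec K)`.
[cite: GortzWedhorn2020, Prop. 3.35 (p. 82) and Cor. 3.36 (p. 83)] [cite: Hartshorne1977, II Ex. 3.14] -/
theorem Over.isIso_of_isClosedImmersion_of_forall_point_factors {X Z : Over (Spec (.of K))}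
    [LocallyOfFiniteType X.hom] [IsReduced X.left] (i : Z ⟶ X) [IsClosedImmersion i.left]
    (h : ∀ p : Over.mk (𝟙 (Spec (.of K))) ⟶ X, ∃ z : Over.mk (𝟙 (Spec (.of K))) ⟶ Z, z ≫ i = p) : IsIso i := by
  haveI : IsIso i.left := by
    refine Literature.AlgebraicGeometry.Morphisms.isIso_of_isClosedImmersion_of_forall_point_factors X.hom i.left
      fun p hp => ?_
    obtain ⟨z, hz⟩ := h (Over.homMk p hp)
    exact ⟨z.left, congrArg CommaMorphism.left hz⟩
  have e : (Over.isoMk (asIso i.left) (by simp [Over.w i])).hom = i := Over.OverMorphism.ext (by simp)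
  rw [← e]
  infer_instance

/-- Surjectivity, Over-category form (no reducedness): the closed immersion `i.left` is surjective as soon as all
`K`-points over `K` factor through `i`. [cite: GortzWedhorn2020, Prop. 3.35 (p. 82) and Cor. 3.36 (p. 83)] -/
theorem Over.surjective_left_of_forall_point_factors {X Z : Over (Spec (.of K))} [LocallyOfFiniteType X.hom]
    (i : Z ⟶ X) [IsClosedImmersion i.left]
    (h : ∀ p : Over.mk (𝟙 (Spec (.of K))) ⟶ X, ∃ z : Over.mk (𝟙 (Spec (.of K))) ⟶ Z, z ≫ i = p) :
    Surjective i.left := by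
  refine Literature.AlgebraicGeometry.Morphisms.surjective_of_forall_point_factors X.hom i.left
    i.left.isClosedEmbedding.isClosed_range fun p hp => ?_
  obtain ⟨z, hz⟩ := h (Over.homMk p hp)
  exact ⟨z.left, congrArg CommaMorphism.left hz⟩

end Literature.AlgebraicGeometry.Morphisms

end
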